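import Summits.QuantumAdvantage.QuantumAdvantage.Theorems.CharDialSegmentMovesE
import Summits.QuantumAdvantage.QuantumAdvantage.Theorems.CharDialRankRate
import HarnessLib

/-!
# CharDial — segment moves, part F: presentation rigidity of the comb family and the escape from the rank dial

Support for `CharDial.WalkHardFJLinOdd` (stmt-QuantumAdvantage-32604), continuing parts D (the family) and E (its HIGH side).  (2) PRESENTATION RIGIDITY (`comb_active`,
`comb_coef_ne_zero`, `comb_coef_eq_zero`): if a comb cut `[S_b(u) ≡ g]` is presented as `h(u_J, ⟨a', u⟩)` with a comb of `≥ p + |J|` teeth, then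
the table is active, `a'` is non-zero on the comb outside `J` and ZERO off the comb outside `J` (an off-comb coefficient would make `h(u_J, ·)`
invariant under a non-zero shift on all of `𝔽_p` — every residue is reached with `u_J` and the bit frozen, by `subsetSum_surj` — hence constant).
(3) ROBUST RANK (`comb_rank_robust`): one active cut per block, private pivots outside the union of their juntas: `B ≤ R + B·t/⌊n/B⌋` for ANY `R`
directions spanning the active rows of ANY presentation with juntas `≤ t`.  (4) `2·cubeRate n < B` eventually (`two_mul_cubeRate_lt_combB`).
★ `combY_escapes_cubeRank`: for all large `n` NO presentation of the comb family with juntas `≤ log₂ n` meets the span hypothesis of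
`cubeRank_hard`; `highOpen_inhabited` adds the HIGH side.  Not claimed: that the comb family is hard.  All statements Prop-free.
-/

set_option autoImplicit false

namespace Summit.QuantumAdvantage.AdviceFreeQNC0.JLinPeel.SegMove

open Finset
open Summit.QuantumAdvantage.AdviceFreeQNC0

variable {n : ℕ} {p : ℕ}

/-! #### presentation rigidity -/

/-- an ACTIVE table: every junta ⊕ form presentation of a comb cut `g < B·K` has a non-constant table, provided the comb has
`≥ p + |J_g|` teeth. -/
theorem comb_active [hp : Fact p.Prime] (D : JLinData p n) (hD : D.strat = combY p n) (g : Fin (n + 1))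
    (hg : g.val < combB p n * combK p n) (hbig : p + (D.J g).card ≤ (combClass n (combB p n) (g.val / combK p n)).card) :
    ¬ ∀ (u : Fin n → Bool) (s s' : ZMod p), D.h g u s = D.h g u s' := by
  intro hconst
  have hp1 : 1 ≤ p := hp.out.one_lt.le
  obtain ⟨j, hjc, hjJ⟩ : ∃ j ∈ combClass n (combB p n) (g.val / combK p n), j ∉ D.J g := by
    by_contra h
    push Not at h
    have := card_le_card (show combClass n (combB p n) (g.val / combK p n) ⊆ D.J g from h)
    omega
  refine combY_not_junta g hg (D.J g) j (mem_filter.1 hjc).2 hjJ (by omega) ?_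
  intro u v huv
  have hu := congrFun (congrFun hD g) u
  have hv := congrFun (congrFun hD g) v
  rw [← hu, ← hv]
  show D.h g u (D.form g u) = D.h g v (D.form g v)
  rw [hconst u (D.form g u) (D.form g v), D.hJ g u v huv]

/-- rigidity (i): the presenting form is NON-ZERO on the comb outside the junta. -/
theorem comb_coef_ne_zero [hp : Fact p.Prime] (D : JLinData p n) (hD : D.strat = combY p n) (g : Fin (n + 1))
    (hg : g.val < combB p n * combK p n) (hbig : p + (D.J g).card ≤ (combClass n (combB p n) (g.val / combK p n)).card)
    (i : Fin n) (hic : i.val % combB p n = g.val / combK p n) (hiJ : i ∉ D.J g) : D.a g i ≠ 0 := by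
  classical
  intro h0
  refine combY_not_junta g hg (univ.erase i) i hic (Finset.notMem_erase i univ) (by omega) ?_
  intro u v huv
  have hv' : v = Function.update u i (v i) := by
    funext k
    by_cases hk : k = i
    · subst hk; simp
    · rw [Function.update_of_ne hk]; exact (huv k (mem_erase.2 ⟨hk, mem_univ k⟩)).symm
  have hu := congrFun (congrFun hD g) u
  have hv := congrFun (congrFun hD g) v
  rw [← hu, ← hv]
  show D.h g u (form (D.a g) u) = D.h g v (form (D.a g) v)
  have hJ : ∀ k ∈ D.J g, u k = v k := by
    intro k hk
    exact huv k (mem_erase.2 ⟨ne_of_mem_of_not_mem hk hiJ, mem_univ k⟩)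
  rw [D.hJ g u v hJ, hv', form_update_of_zero _ u i h0]

/-- rigidity (ii): the presenting form VANISHES off the comb outside the junta. -/
theorem comb_coef_eq_zero [hp : Fact p.Prime] (D : JLinData p n) (hD : D.strat = combY p n) (g : Fin (n + 1))
    (hg : g.val < combB p n * combK p n) (hbig : p + (D.J g).card ≤ (combClass n (combB p n) (g.val / combK p n)).card)
    (i : Fin n) (hic : i.val % combB p n ≠ g.val / combK p n) (hiJ : i ∉ D.J g) : D.a g i = 0 := by
  classical
  by_contra h0
  set B := combB p n
  set b := g.val / combK p n
  set a' := D.a g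
  set T := combClass n B b \ D.J g with hT
  have hTnz : ∀ j ∈ T, a' j ≠ 0 := by
    intro j hj
    rcases mem_sdiff.1 hj with ⟨hjc, hjJ⟩
    exact comb_coef_ne_zero D hD g hg hbig j (mem_filter.1 hjc).2 hjJ
  have hTcard : p ≤ T.card + 1 := by
    have := le_card_sdiff (D.J g) (combClass n B b)
    rw [← hT] at this
    omega
  have hiT : i ∉ combClass n B b := fun h => hic (mem_filter.1 h).2
  -- step 1: invariance of the table under flipping bit `i`
  have hstep1 : ∀ u : Fin n → Bool,
      D.h g u (form a' u + (if u i = true then -a' i else a' i)) = D.h g u (form a' u) := by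
    intro u
    have hu := congrFun (congrFun hD g) u
    have hv := congrFun (congrFun hD g) (Function.update u i (!u i))
    have hy : combY p n g (Function.update u i (!u i)) = combY p n g u := by
      unfold combY; rw [form_comb_update_not_mem u i hic]
    have hJ : ∀ k ∈ D.J g, Function.update u i (!u i) k = u k := by
      intro k hk; rw [Function.update_of_ne (ne_of_mem_of_not_mem hk hiJ)]
    have hf : form a' (Function.update u i (!u i)) = form a' u + (if u i = true then -a' i else a' i) := by
      rw [form_update]
      cases u i <;> simp [sub_eq_add_neg]
    have : D.strat g (Function.update u i (!u i)) = D.strat g u := by rw [hu, hv, hy]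
    change D.h g (Function.update u i (!u i)) (form a' (Function.update u i (!u i))) = D.h g u (form a' u) at this
    rwa [D.hJ g _ u hJ, hf] at this
  -- step 2: every residue is reached with the junta bits and bit `i` frozen
  have hstep2 : ∀ (u : Fin n → Bool) (σ : ZMod p), ∃ w : Fin n → Bool,
      (∀ k ∈ D.J g, w k = u k) ∧ w i = u i ∧ form a' w = σ := by
    intro u σ
    let u₀ : Fin n → Bool := fun k => if k ∈ T then false else u k
    obtain ⟨S, hS, hsum⟩ := subsetSum_surj a' T hTnz hTcard (form a' u₀) σ
    refine ⟨fun k => if k ∈ S then true else u₀ k, ?_, ?_, ?_⟩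
    · intro k hk
      have hkT : k ∉ T := fun h => (mem_sdiff.1 h).2 hk
      have hkS : k ∉ S := fun h => hkT (hS h)
      simp [u₀, hkS, hkT]
    · have hiT' : i ∉ T := fun h => hiT (mem_sdiff.1 h).1
      have hiS : i ∉ S := fun h => hiT' (hS h)
      simp [u₀, hiS, hiT']
    · rw [form_setTrue a' u₀ S (fun j hj => by simp [u₀, hS hj]), hsum]
  -- step 3: the table of every `u` is invariant under `± a'_i` on all of `𝔽_p`
  have hstep3 : ∀ (u : Fin n → Bool) (σ : ZMod p),
      D.h g u (σ + (if u i = true then -a' i else a' i)) = D.h g u σ := by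
    intro u σ
    obtain ⟨w, hwJ, hwi, hwσ⟩ := hstep2 u σ
    have h1 := hstep1 w
    rw [hwσ, hwi, D.hJ g w u hwJ, D.hJ g w u hwJ] at h1
    exact h1
  -- step 4: hence constant — contradicting activity
  refine comb_active D hD g hg hbig ?_
  intro u s s'
  set ε : ZMod p := if u i = true then -a' i else a' i with hε
  have hε0 : ε ≠ 0 := by
    rw [hε]; split_ifs
    · exact neg_ne_zero.2 h0
    · exact h0
  have hk : ∀ k : ℕ, D.h g u (s + (k : ZMod p) * ε) = D.h g u s := by
    intro k
    induction k with
    | zero => simp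
    | succ k ih =>
      have := hstep3 u (s + (k : ZMod p) * ε)
      push_cast
      rw [add_mul, one_mul, ← add_assoc, this, ih]
  have := hk ((s' - s) * ε⁻¹).val
  rw [ZMod.natCast_zmod_val, inv_mul_cancel_right₀ hε0, add_sub_cancel] at this
  exact this.symm

/-! #### rank -/

/-- **robust rank**: for EVERY junta ⊕ form presentation `D` of the comb family whose combs have `≥ p + |junta|` teeth, any `R` directions
spanning the active rows satisfy `B ≤ R + (B·t)/⌊n/B⌋`, where `t` bounds the junta sizes. -/
theorem comb_rank_robust [hp : Fact p.Prime] (D : JLinData p n) (hD : D.strat = combY p n) {t : ℕ}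
    (hJ : ∀ g, (D.J g).card ≤ t) (hbig : ∀ g : Fin (n + 1), g.val < combB p n * combK p n →
      p + (D.J g).card ≤ (combClass n (combB p n) (g.val / combK p n)).card)
    {R : ℕ} (A : Fin R → Fin n → ZMod p)
    (hA : ∀ g, ¬ (∀ (u : Fin n → Bool) (s s' : ZMod p), D.h g u s = D.h g u s') →
      ∃ l : Fin R → ZMod p, D.a g = fun i => ∑ j, l j * A j i) :
    combB p n ≤ R + combB p n * t / (n / combB p n) := by
  classical
  set B := combB p n with hB
  set K := combK p n with hK
  have hK0 : 0 < K := combK_pos n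
  have hBK : B * K ≤ n + 1 := combB_mul_le p n
  by_cases hB0 : B = 0
  · rw [hB0]; exact Nat.zero_le _
  have hBpos : 0 < B := Nat.pos_of_ne_zero hB0
  -- one cut per block
  have hglt : ∀ b : Fin B, b.val * K < n + 1 := fun b =>
    lt_of_lt_of_le (Nat.mul_lt_mul_of_pos_right b.isLt hK0) hBK
  let gb : Fin B → Fin (n + 1) := fun b => ⟨b.val * K, hglt b⟩
  have hgb_div : ∀ b : Fin B, (gb b).val / K = b.val := fun b => Nat.mul_div_cancel b.val hK0
  have hgb_lt : ∀ b : Fin B, (gb b).val < B * K := fun b => Nat.mul_lt_mul_of_pos_right b.isLt hK0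
  have hbig' : ∀ b : Fin B, p + (D.J (gb b)).card ≤ (combClass n B ((gb b).val / K)).card := fun b => hbig (gb b) (hgb_lt b)
  -- the active rows lie in the span of the rows of `A`
  let S : Submodule (ZMod p) (Fin n → ZMod p) := Submodule.span (ZMod p) (Set.range A)
  have hmem : ∀ b : Fin B, D.a (gb b) ∈ S := by
    intro b
    obtain ⟨l, hl⟩ := hA (gb b) (comb_active D hD (gb b) (hgb_lt b) (hbig' b))
    rw [hl, Submodule.mem_span_range_iff_exists_fun]
    refine ⟨l, ?_⟩
    funext i
    simp [Finset.sum_apply, Pi.smul_apply, smul_eq_mul]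
  -- union of the chosen juntas and the good blocks
  let U : Finset (Fin n) := univ.biUnion fun b : Fin B => D.J (gb b)
  have hU : U.card ≤ B * t := by
    refine le_trans card_biUnion_le ?_
    have : ∑ b : Fin B, (D.J (gb b)).card ≤ ∑ _b : Fin B, t := sum_le_sum fun b _ => hJ (gb b)
    simpa using this
  let good : Finset (Fin B) := univ.filter fun b : Fin B => ∃ i : Fin n, i.val % B = b.val ∧ i ∉ U
  -- the good rows are linearly independent (private pivots)
  have hli : LinearIndependent (ZMod p) (fun x : {b // b ∈ good} => D.a (gb x.1)) := by
    rw [Fintype.linearIndependent_iff]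
    intro c hc x₀
    obtain ⟨i₀, hi₀, hi₀U⟩ := (mem_filter.1 x₀.2).2
    have h := congrFun hc i₀
    simp only [Finset.sum_apply, Pi.smul_apply, smul_eq_mul, Pi.zero_apply] at h
    rw [Finset.sum_eq_single x₀] at h
    · have hne : D.a (gb x₀.1) i₀ ≠ 0 :=
        comb_coef_ne_zero D hD (gb x₀.1) (hgb_lt _) (hbig' _) i₀ (by rw [hgb_div]; exact hi₀)
          (fun hmem => hi₀U (mem_biUnion.2 ⟨x₀.1, mem_univ _, hmem⟩))
      exact (mul_eq_zero.1 h).resolve_right hne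
    · intro x _ hx
      have hxv : x.1.val ≠ x₀.1.val := fun h' => hx (Subtype.ext (Fin.ext h'))
      have hz : D.a (gb x.1) i₀ = 0 :=
        comb_coef_eq_zero D hD (gb x.1) (hgb_lt _) (hbig' _) i₀ (by rw [hgb_div, hi₀]; exact fun h' => hxv h'.symm)
          (fun hmem => hi₀U (mem_biUnion.2 ⟨x.1, mem_univ _, hmem⟩))
      rw [hz, mul_zero]
    · intro h; exact absurd (mem_univ x₀) h
  let w : {b // b ∈ good} → S := fun x => ⟨D.a (gb x.1), hmem x.1⟩
  have hw : LinearIndependent (ZMod p) w := LinearIndependent.of_comp S.subtype hli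
  have h1 := hw.fintype_card_le_finrank
  have h2 : Module.finrank (ZMod p) S ≤ Fintype.card (Fin R) := finrank_range_le_card A
  rw [Fintype.card_coe] at h1
  rw [Fintype.card_fin] at h2
  have hgoodR : good.card ≤ R := le_trans h1 h2
  -- the bad blocks have their whole comb inside `U`
  let bad : Finset (Fin B) := univ.filter fun b : Fin B => ¬ ∃ i : Fin n, i.val % B = b.val ∧ i ∉ U
  have hsplit : good.card + bad.card = B := by
    have := card_filter_add_card_filter_not (s := (univ : Finset (Fin B)))
      (fun b : Fin B => ∃ i : Fin n, i.val % B = b.val ∧ i ∉ U)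
    rw [card_univ, Fintype.card_fin] at this
    exact this
  have hbadU : bad.biUnion (fun b : Fin B => combClass n B b.val) ⊆ U := by
    intro i hi
    rcases mem_biUnion.1 hi with ⟨b, hb, hic⟩
    have hb' := (mem_filter.1 hb).2
    by_contra hiU
    exact hb' ⟨i, (mem_filter.1 hic).2, hiU⟩
  have hdisj : (bad : Set (Fin B)).PairwiseDisjoint (fun b : Fin B => combClass n B b.val) := by
    intro x _ y _ hxy
    simp only [Function.onFun]
    rw [Finset.disjoint_left]
    intro i hix hiy
    exact hxy (Fin.ext ((mem_filter.1 hix).2.symm.trans (mem_filter.1 hiy).2))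
  have hsum : bad.card * (n / B) ≤ U.card := by
    have h1 : bad.card • (n / B) ≤ ∑ b ∈ bad, (combClass n B b.val).card :=
      card_nsmul_le_sum bad _ _ fun b _ => card_combClass_ge hBpos b.isLt
    rw [smul_eq_mul] at h1
    refine le_trans h1 ?_
    rw [← card_biUnion hdisj]
    exact card_le_card hbadU
  -- `⌊n/B⌋ > 0` since `K ≥ 2`
  have hnB : 0 < n / B := by
    have hK2 : 2 ≤ K := by
      have : 9 ≤ dialM n := by unfold dialM; omega
      exact le_trans (by omega) (Nat.mul_le_mul hp.out.two_le this)
    have : B ≤ (n + 1) / 2 := by rw [hB]; exact Nat.div_le_div_left hK2 (by norm_num)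
    apply Nat.div_pos _ hBpos
    omega
  have hbad : bad.card ≤ B * t / (n / B) := by
    rw [Nat.le_div_iff_mul_le hnB]
    exact le_trans hsum hU
  omega

/-! #### arithmetic: the cube-root rank budget is below the number of blocks -/

/-- eventually `2·cubeRate n < B`. -/
theorem two_mul_cubeRate_lt_combB (p : ℕ) [hp : Fact p.Prime] : ∃ n₁, ∀ n ≥ n₁, 2 * cubeRate n < combB p n := by
  have hp0 : 0 < p := hp.out.pos
  have hp2 : 2 ≤ p := hp.out.two_le
  obtain ⟨n₁, hn₁⟩ := eventually_mul_log_le (9 * p)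
  refine ⟨max (max n₁ 2) (365 * p ^ 2), fun n hn => ?_⟩
  have h9 := hn₁ n (le_trans (le_trans (le_max_left _ _) (le_max_left _ _)) hn)
  have hn2 : 2 ≤ n := le_trans (le_trans (le_max_right _ _) (le_max_left _ _)) hn
  have hn365 : 365 * p ^ 2 ≤ n := le_trans (le_max_right _ _) hn
  set t := Nat.log 2 n with ht
  set ρ := cubeRate n with hρ
  set K := combK p n with hK
  set B := combB p n with hB
  have ht1 : 1 ≤ t := Nat.le_log_of_pow_le (by norm_num) (by simpa using hn2)
  have hK0 : 0 < K := combK_pos n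
  have hKle : K ≤ n + 1 := by
    have : K = p * (8 * t + 9) := rfl
    nlinarith
  have hB1 : 1 ≤ B := by
    rw [hB, combB, Nat.le_div_iff_mul_le hK0, one_mul]; exact hKle
  have hspec : ρ ^ 3 * t ^ 5 ≤ n := cubeRate_spec n
  by_contra hcon
  push Not at hcon
  -- `ρ ≥ 1`
  have hρ1 : 1 ≤ ρ := by omega
  have hK17 : K ≤ 17 * (p * t) := by
    have : K = p * (8 * t + 9) := rfl
    nlinarith
  have hlt : n + 1 < B * K + K := by rw [hB, combB]; exact Nat.lt_div_mul_add hK0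
  have h3 : B * K + K ≤ 3 * ρ * K := by nlinarith
  have h4 : 3 * ρ * K ≤ 3 * ρ * (17 * (p * t)) := Nat.mul_le_mul_left _ hK17
  have h2 : n < 3 * ρ * (17 * (p * t)) := by omega
  have hcube : n ^ 3 < (3 * ρ * (17 * (p * t))) ^ 3 := Nat.pow_lt_pow_left h2 (by norm_num)
  have ht2 : 0 < t ^ 2 := by positivity
  have hkey : n ^ 3 * t ^ 2 < 132651 * p ^ 3 * n := by
    calc n ^ 3 * t ^ 2 < (3 * ρ * (17 * (p * t))) ^ 3 * t ^ 2 := Nat.mul_lt_mul_of_pos_right hcube ht2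
      _ = 132651 * p ^ 3 * (ρ ^ 3 * t ^ 5) := by ring
      _ ≤ 132651 * p ^ 3 * n := Nat.mul_le_mul_left _ hspec
  have hkey2 : n ^ 2 * t ^ 2 < 132651 * p ^ 3 := by
    have h' : n * (n ^ 2 * t ^ 2) < n * (132651 * p ^ 3) := by
      calc n * (n ^ 2 * t ^ 2) = n ^ 3 * t ^ 2 := by ring
        _ < 132651 * p ^ 3 * n := hkey
        _ = n * (132651 * p ^ 3) := by ring
    exact Nat.lt_of_mul_lt_mul_left h'
  have hsq : (365 * p ^ 2) ^ 2 ≤ n ^ 2 := Nat.pow_le_pow_left hn365 2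
  have hp34 : p ^ 3 ≤ p ^ 4 := Nat.pow_le_pow_right hp0 (by norm_num)
  have : (365 * p ^ 2) ^ 2 = 133225 * p ^ 4 := by ring
  nlinarith

/-- **ESCAPE FROM THE RANK DIAL (every presentation).** for every prime `p` and all large `n`: NO junta ⊕ form presentation of the comb family
with juntas of size `≤ log₂ n` has its active rows in the span of `cubeRate n` directions — the hypothesis of `JLinPeel.cubeRank_hard` fails for
every presentation of `combY p n`. -/
theorem combY_escapes_cubeRank (p : ℕ) [hp : Fact p.Prime] : ∃ n₁, ∀ n ≥ n₁, ∀ D : JLinData p n, D.strat = combY p n →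
    (∀ g, (D.J g).card ≤ Nat.log 2 n) →
    ¬ ∃ A : Fin (cubeRate n) → Fin n → ZMod p,
      ∀ g, ¬ (∀ (u : Fin n → Bool) (s s' : ZMod p), D.h g u s = D.h g u s') →
        ∃ l : Fin (cubeRate n) → ZMod p, D.a g = fun i => ∑ j, l j * A j i := by
  have hp0 : 0 < p := hp.out.pos
  have hp2 : 2 ≤ p := hp.out.two_le
  obtain ⟨n₁, hn₁⟩ := two_mul_cubeRate_lt_combB p
  refine ⟨n₁, fun n hn D hD hJ => ?_⟩
  have hρ := hn₁ n hn
  have hK0 : 0 < combK p n := combK_pos n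
  have hBpos : 0 < combB p n := by omega
  have hBK : combB p n * combK p n ≤ n + 1 := combB_mul_le p n
  -- comb sizes: `⌊n/B⌋ ≥ K − 1 ≥ p + t` and `≥ 16 t`
  have hnB : combK p n - 1 ≤ n / combB p n := by
    rw [Nat.le_div_iff_mul_le hBpos, Nat.sub_one_mul]
    have : combK p n * combB p n = combB p n * combK p n := mul_comm _ _
    omega
  have hKexp : combK p n = p * (8 * Nat.log 2 n + 9) := rfl
  have hKbig : p + Nat.log 2 n + 1 ≤ combK p n := by rw [hKexp]; nlinarith
  have hK16 : 16 * Nat.log 2 n + 1 ≤ combK p n := by rw [hKexp]; nlinarith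
  have hbig : ∀ g : Fin (n + 1), g.val < combB p n * combK p n →
      p + (D.J g).card ≤ (combClass n (combB p n) (g.val / combK p n)).card := by
    intro g hg
    have hb : g.val / combK p n < combB p n := by
      rw [Nat.div_lt_iff_lt_mul hK0]; exact hg
    have := card_combClass_ge (n := n) hBpos hb
    have := hJ g
    omega
  rintro ⟨A, hA⟩
  have hr := comb_rank_robust D hD hJ hbig A hA
  -- `B·t/⌊n/B⌋ ≤ B/16`
  have hfrac : combB p n * Nat.log 2 n / (n / combB p n) ≤ combB p n / 16 := by
    rcases Nat.eq_zero_or_pos (Nat.log 2 n) with ht0 | htpos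
    · rw [ht0]; simp
    · calc combB p n * Nat.log 2 n / (n / combB p n) ≤ combB p n * Nat.log 2 n / (16 * Nat.log 2 n) :=
            Nat.div_le_div_left (by omega) (by omega)
        _ = combB p n / 16 := by rw [Nat.mul_div_mul_right _ _ htpos]
  omega

/-- **SEPARATION IN THE OPEN REGIME.** for every prime `p` and all large `n` the comb family (which satisfies the CharDial hypothesis by
`combY_jlin`) lies on the HIGH side of the variation dial at threshold `4(log₂ n + 1)`, and NO junta ⊕ form presentation of it with juntas
`≤ log₂ n` meets the span hypothesis of `cubeRank_hard`. -/
theorem highOpen_inhabited (p : ℕ) [hp : Fact p.Prime] : ∃ n₁, ∀ n ≥ n₁,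
    ¬ (n ≤ 2 * (lowPositions n (combY p n) (4 * (Nat.log 2 n + 1))).card) ∧
      ∀ D : JLinData p n, D.strat = combY p n → (∀ g, (D.J g).card ≤ Nat.log 2 n) →
        ¬ ∃ A : Fin (cubeRate n) → Fin n → ZMod p,
          ∀ g, ¬ (∀ (u : Fin n → Bool) (s s' : ZMod p), D.h g u s = D.h g u s') →
            ∃ l : Fin (cubeRate n) → ZMod p, D.a g = fun i => ∑ j, l j * A j i := by
  have hp0 : 0 < p := hp.out.pos
  obtain ⟨n₁, hn₁⟩ := eventually_mul_log_le (18 * p)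
  obtain ⟨n₂, hn₂⟩ := combY_escapes_cubeRank p
  refine ⟨max (max n₁ n₂) 3, fun n hn => ?_⟩
  have h1 := hn₁ n (le_trans (le_trans (le_max_left _ _) (le_max_left _ _)) hn)
  have h2 := hn₂ n (le_trans (le_trans (le_max_right _ _) (le_max_left _ _)) hn)
  have hn3 : 3 ≤ n := le_trans (le_max_right _ _) hn
  have hK0 : 0 < combK p n := combK_pos n
  have hB2 : 2 ≤ combB p n := by
    unfold combB
    rw [Nat.le_div_iff_mul_le hK0]
    have : combK p n = p * (8 * Nat.log 2 n + 9) := rfl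
    nlinarith
  exact ⟨not_low_combY hn3 hB2, h2⟩

end Summit.QuantumAdvantage.AdviceFreeQNC0.JLinPeel.SegMove
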